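import Summits.Ventures.CertifiedManyBodySolver.Downfold.EmeryShapeTrueCornerRule
import Summits.Ventures.CertifiedManyBodySolver.Downfold.EmeryFermiScalePointsCCOCK26TrueCorners
import Summits.Ventures.CertifiedManyBodySolver.Downfold.EmeryFermiScalePointsCCOCK26VirtualCorners
import HarnessLib

/-!
# THE ONE-BAND FERMI-SURFACE SHAPE `t′/t` OF THE WHOLE TYPED 3BE BOX `emeryBoxCCOCK26Src (EmeryBoxesKSlicesB)` AT ITS TWO TRUE CORNERS (true-corner rule under certified margins, §B.87 (i);
# router/EMERY-SHAPE-CORNERS.tsv «true» rows)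

Venture CertifiedManyBodySolver, cell `pub/hubbard-downfold` (stage S1; INFLATION-RULES-3to1-B §B.87 (i)), seat hubbard-downfold-mod-4 (technique B, g35); namespace
`Summit.Ventures.CertifiedManyBodySolver.Downfold.Emery`. Everything PROVED (0 sorry). WHAT THIS IS NOT: a statement about Ca₂₋ₓNaₓCuO₂Cl₂ x = 0.10 ((K) #3 source box) — the typed box is SCREENING-GRADE; `U = 0`
one-body kinematics of the σ model; object E = the EXACT `t–t′` shape of the σ Fermi surface at the row's own Fermi energy.

For EVERY one-body row of `[2.05, 2.66] × [1.17, 1.39] × [0.58, 0.69] × [0.13, 0.136]` eV the one-band `t′/t` lies between its values at the TRUE corners `(Δ₁, a₁, b₂, c₂)` and `(Δ₂, a₂, b₁, c₁)`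
(`EmeryShapeTrueCornerRule`; the t_pp / t_pp′ directions by the MARGIN LEVERS of `EmeryMarginLevers`, margins certified by `norm_num` with the constants `M` printed below), read
over their K = 384 brackets (`EmeryFermiScalePointsCCOCK26TrueCorners`).

| filling | **true-corner window (certified)** | margins (t_pp lower/upper; t_pp′ lower/upper) | two-ray (§B.86 (i)) | g19 sub-box device |
|---|---|---|---|---|
| n_H = 1.10 (ν = 9/20) | **[-0.2939, -0.2341]** | M_b 0.2126 / 2.1099; M_c 0.0 / 0.0 | see EmeryBoxesCCOCK26ShapeCorners | [-0.2954,-0.232] |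

Sources: three-band model [HybertsenSchluterChristensen1989, Eq. (1)]; [AndersenEtAl1995, §6]; box rows as cited in the typed object's file.
-/

noncomputable section

namespace Summit.Ventures.CertifiedManyBodySolver.Downfold.Emery

open Real Set

/-- **n_H = 1.10 (ν = 9/20): for every row of the box the one-band Fermi-surface `t′/t` (object E) lies in `[-0.2939, -0.2341]` — its values at the two TRUE corners** (margin levers; margins by `norm_num`). [folklore] -/
theorem cCOCK26Box_fsRatio_true_nH110 {Δ a b c : ℝ} (hΔ : Δ ∈ Icc ((41 : ℝ) / 20) ((133 : ℝ) / 50)) (ha : a ∈ Icc ((117 : ℝ) / 100) ((139 : ℝ) / 100)) (hb : b ∈ Icc ((29 : ℝ) / 50) ((69 : ℝ) / 100)) (hc : c ∈ Icc ((13 : ℝ) / 100) ((17 : ℝ) / 125)) :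
    fsRatio Δ a b c (fermiEnergyOf Δ a b c ((9 : ℝ) / 20)) ∈ Icc ((-2939 : ℝ) / 10000) ((-2341 : ℝ) / 10000) := by
  have hSL := (fermiEnergyOf_of_pointBracketCheck truePt_CCOCK26SL_nH110_br (by norm_num) (by norm_num) (by norm_num) (ν := (9/20 : ℝ)) (by push_cast; exact ⟨le_rfl, le_rfl⟩)).2
  have hTL := (fermiEnergyOf_of_pointBracketCheck truePt_CCOCK26TL_nH110_br (by norm_num) (by norm_num) (by norm_num) (ν := (9/20 : ℝ)) (by push_cast; exact ⟨le_rfl, le_rfl⟩)).2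
  have hSU := (fermiEnergyOf_of_pointBracketCheck truePt_CCOCK26SU_nH110_br (by norm_num) (by norm_num) (by norm_num) (ν := (9/20 : ℝ)) (by push_cast; exact ⟨le_rfl, le_rfl⟩)).2
  have hQU := (fermiEnergyOf_of_pointBracketCheck truePt_CCOCK26QU_nH110_br (by norm_num) (by norm_num) (by norm_num) (ν := (9/20 : ℝ)) (by push_cast; exact ⟨le_rfl, le_rfl⟩)).2
  have hTH := (fermiEnergyOf_of_pointBracketCheck truePt_CCOCK26TH_nH110_br (by norm_num) (by norm_num) (by norm_num) (ν := (9/20 : ℝ)) (by push_cast; exact ⟨le_rfl, le_rfl⟩)).2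
  have hAlo := (fermiEnergyOf_of_pointBracketCheck virtPt_CCOCK26Alo_nH110_br (by norm_num) (by norm_num) (by norm_num) (ν := (9/20 : ℝ)) (by push_cast; exact ⟨le_rfl, le_rfl⟩)).2
  have hTop := (fermiEnergyOf_of_pointBracketCheck virtPt_CCOCK26H_nH110_br (by norm_num) (by norm_num) (by norm_num) (ν := (9/20 : ℝ)) (by push_cast; exact ⟨le_rfl, le_rfl⟩)).2
  push_cast at hSL hTL hSU hQU hTH hAlo hTop
  norm_num at hSL hTL hSU hQU hTH hAlo hTop
  obtain ⟨hΔl, hΔu⟩ := hΔ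
  obtain ⟨hal, hau⟩ := ha
  constructor
  · have hlow := fsRatio_fermiEnergyOf_trueCorner_lower (Δ₁ := ((41 : ℝ) / 20)) (a₁ := ((117 : ℝ) / 100)) (b₁ := ((29 : ℝ) / 50)) (b₂ := ((69 : ℝ) / 100)) (c₁ := ((13 : ℝ) / 100)) (c₂ := ((17 : ℝ) / 125))
      (ν := ((9 : ℝ) / 20)) (pL := ((3707 : ℝ) / 2500)) (qL := ((3837 : ℝ) / 2500)) (Mb := ((1063 : ℝ) / 5000)) (Mc := (0 : ℝ)) (by norm_num) hΔl (by norm_num) hal (by norm_num) hb (by norm_num) hc (by norm_num) (by norm_num) (by norm_num)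
      (by norm_num) hSL.1 hAlo.2 (by norm_num) (by norm_num [fsD, fsN]) (by norm_num) (by norm_num) (by norm_num [fsD, fsN]) (by norm_num) (by norm_num [dopingDisc]) (by norm_num [fsD, fsN])
    refine le_trans ?_ hlow
    have hw := (fsRatio_mem_Icc_on_window_of_dopingDisc_nonpos (Δ := ((41 : ℝ) / 20)) (a := ((117 : ℝ) / 100)) (b := ((69 : ℝ) / 100)) (c := ((17 : ℝ) / 125))
      (p := ((607 : ℝ) / 400)) (q := ((611 : ℝ) / 400)) (by norm_num) (by norm_num) (by norm_num) (by norm_num) (by norm_num) (by norm_num) (by norm_num) (by norm_num [dopingDisc]) hTL).1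
    refine le_trans ?_ hw
    norm_num [fsRatio, fsD, fsN]
  · have hup := fsRatio_fermiEnergyOf_trueCorner_upper (Δ₁ := ((41 : ℝ) / 20)) (Δ₂ := ((133 : ℝ) / 50)) (a₁ := ((117 : ℝ) / 100)) (a₂ := ((139 : ℝ) / 100)) (b₁ := ((29 : ℝ) / 50)) (b₂ := ((69 : ℝ) / 100)) (c₁ := ((13 : ℝ) / 100)) (c₂ := ((17 : ℝ) / 125))
      (ν := ((9 : ℝ) / 20)) (pU := ((4213 : ℝ) / 2500)) (qU := ((433 : ℝ) / 250)) (qT := ((2411 : ℝ) / 1250)) (Mb := ((21099 : ℝ) / 10000)) (Mc := (0 : ℝ)) (by norm_num) ⟨hΔl, hΔu⟩ (by norm_num) ⟨hal, hau⟩ (by norm_num) hb (by norm_num) hc (by norm_num) (by norm_num) (by norm_num)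
      hTop.2 (by norm_num) (by norm_num) hSU.1 hQU.2 (by norm_num) (by norm_num [fsD, fsN]) (by norm_num) (by norm_num) (by norm_num [fsD, fsN]) (by norm_num) (by norm_num) (by norm_num [fsD, fsN])
    refine le_trans hup ?_
    have hw := (fsRatio_mem_Icc_on_window_of_dopingDisc_nonpos (Δ := ((133 : ℝ) / 50)) (a := ((139 : ℝ) / 100)) (b := ((29 : ℝ) / 50)) (c := ((13 : ℝ) / 100))
      (p := ((16873 : ℝ) / 10000)) (q := ((17023 : ℝ) / 10000)) (by norm_num) (by norm_num) (by norm_num) (by norm_num) (by norm_num) (by norm_num) (by norm_num) (by norm_num [dopingDisc]) hTH).2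
    refine le_trans hw ?_
    norm_num [fsRatio, fsD, fsN]

end Summit.Ventures.CertifiedManyBodySolver.Downfold.Emery
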